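/-
Copyright (c) 2026. All rights reserved.
Released under Apache 2.0 license as described in the file LICENSE.
Authors: abc-iut cell, statement-typer seat abc-iut-L4-t14 (wave 2).
-/
import Literature.AnabelianGeometry.AbsoluteAnabelian.AutHolomorphicSpaces
import HarnessLib

/-!
# [AbsTopIII] Remark 2.3.2: co-holomorphicizations do not depend on the choice of local structures

S. Mochizuki, *Topics in absolute anabelian geometry III: global reconstruction algorithms*,
J. Math. Sci. Univ. Tokyo 22 (2015) 939–1156 [MochizukiAbsTopIII2015]; locator = page of the author's
kurims manuscript (`paper:url-5493eb38cbb7`), read on the page.  Companion of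
`AbsTopIII/RemarksArchimedean.lean` (the other eleven §2 Remarks of block W2-B5); this one is separate
because it is stated over the §2 vocabulary of `AutHolomorphicSpaces.lean` (seat abc-iut-L4-t2):
`IsLocalStructure` (Def 2.1 (i) p.50), `IsLocalMorphism` ((𝒰,𝒱)-local morphisms of Aut-holomorphic
spaces, Def 2.1 (ii) pp.50–51), `AutHolStructure.ofCharted` (the Aut-holomorphic space of a Riemann
surface).

Remark 2.3.2 p.54: "It follows, in particular, from Corollary 2.3, (ii), that [in the notation of
Definition 2.1, (iv)] the notion of a co-holomorphicization `𝕏 → 𝕐` is, in fact, independent of the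
choice of the local structures `𝒰`, `𝒱`."  A co-holomorphicization (Def 2.1 (iv) pp.51–52) is a
section of the sheafification of the presheaf of classes of (𝒰,𝒱)-local morphisms of Aut-holomorphic
spaces (from open subsets of `X^top` to `𝕐`) under the relation "co-holomorphic" = "the underlying local
isomorphisms are co-oriented" (Def 2.1 (iii)), a relation that involves only the underlying maps.  The
dependence on `(𝒰, 𝒱)` therefore sits entirely in WHICH maps are (𝒰,𝒱)-local morphisms, and the Remark
is typed as the statement that, between the Aut-holomorphic spaces of Riemann surfaces, this class of
maps is the same for every pair of local structures (`Rmk_2_3_2`, a named `Prop` fact — by Cor 2.3 (i)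
it is the class of étale RC-holomorphic maps; not proved here).  Since every open subset of a Riemann
surface is again a Riemann surface and a local structure restricts to one on each open subset, the
statement for global maps `X → Y` covers the local representatives of a co-holomorphicization.
Refereed pre-IUT anabelian geometry; nothing here bears on the disputed [IUTchIII] Cor. 3.12; the fact
is quoted, not asserted.
-/

set_option autoImplicit false

namespace Literature.AnabelianGeometry.AbsoluteAnabelian.AbsTopIII

open _root_.TopologicalSpace
open scoped _root_.Manifold _root_.ContDiff

/-- **Remark 2.3.2**: "the notion of a co-holomorphicization `𝕏 → 𝕐` is, in fact, independent of the
choice of the local structures `𝒰`, `𝒱`" [a consequence of Cor 2.3 (ii)] — TYPED as: for Riemann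
surfaces `X`, `Y` and any two pairs `(𝒰, 𝒱)`, `(𝒰', 𝒱')` of local structures on `X^top`, `Y^top`, a map
`φ : X^top → Y^top` is a (𝒰,𝒱)-local morphism of the associated Aut-holomorphic spaces if and only if
it is a (𝒰',𝒱')-local morphism (stated as an implication, symmetric in the data); the classes of such
maps under "co-holomorphic", hence the (pre-)co-holomorphicizations of Def 2.1 (iv), are then literally
the same for all choices.  NAMED FACT (unproved published remark; not asserted).  Why it is not a formal
consequence of the typed Cor 2.3 facts of `AutHolomorphicSpaces.lean`: `LocalMorphismIsRCHolomorphic`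
gives "(𝒰,𝒱)-local ⇒ RC-holomorphic", but the converse "an étale RC-holomorphic map transports
`Aut^hol(U')` onto `Aut^hol(V')` for ALL connected opens" needs the calculus of anti-holomorphic maps on
Riemann surfaces (conjugating a holomorphic automorphism by an anti-holomorphic isomorphism is
holomorphic), which Mathlib does not provide; the printed route via Cor 2.3 (ii) needs transport of
complex-manifold structures along homeomorphisms, likewise absent.
[cite: MochizukiAbsTopIII2015, Rmk 2.3.2 p.54] -/
def Rmk_2_3_2 : Prop :=
  ∀ (X Y : Type) [TopologicalSpace X] [T2Space X] [ChartedSpace ℂ X] [IsManifold 𝓘(ℂ, ℂ) ω X]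
    [TopologicalSpace Y] [T2Space Y] [ChartedSpace ℂ Y] [IsManifold 𝓘(ℂ, ℂ) ω Y]
    (𝒰 𝒰' : Set (Opens X)) (𝒱 𝒱' : Set (Opens Y)),
    IsLocalStructure X 𝒰 → IsLocalStructure X 𝒰' → IsLocalStructure Y 𝒱 → IsLocalStructure Y 𝒱' →
    ∀ φ : X → Y,
      IsLocalMorphism (AutHolStructure.ofCharted X) (AutHolStructure.ofCharted Y) 𝒰 𝒱 φ →
      IsLocalMorphism (AutHolStructure.ofCharted X) (AutHolStructure.ofCharted Y) 𝒰' 𝒱' φ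

/-- The typed form is symmetric: under `Rmk_2_3_2` the (𝒰,𝒱)- and (𝒰',𝒱')-local morphisms are the
same class of maps (the "independence" as an `↔`). [cite: MochizukiAbsTopIII2015, Rmk 2.3.2 p.54] -/
theorem Rmk_2_3_2.iff (h : Rmk_2_3_2) (X Y : Type) [TopologicalSpace X] [T2Space X] [ChartedSpace ℂ X]
    [IsManifold 𝓘(ℂ, ℂ) ω X] [TopologicalSpace Y] [T2Space Y] [ChartedSpace ℂ Y]
    [IsManifold 𝓘(ℂ, ℂ) ω Y] {𝒰 𝒰' : Set (Opens X)} {𝒱 𝒱' : Set (Opens Y)}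
    (h𝒰 : IsLocalStructure X 𝒰) (h𝒰' : IsLocalStructure X 𝒰') (h𝒱 : IsLocalStructure Y 𝒱)
    (h𝒱' : IsLocalStructure Y 𝒱') (φ : X → Y) :
    IsLocalMorphism (AutHolStructure.ofCharted X) (AutHolStructure.ofCharted Y) 𝒰 𝒱 φ ↔
      IsLocalMorphism (AutHolStructure.ofCharted X) (AutHolStructure.ofCharted Y) 𝒰' 𝒱' φ :=
  ⟨h X Y 𝒰 𝒰' 𝒱 𝒱' h𝒰 h𝒰' h𝒱 h𝒱' φ, h X Y 𝒰' 𝒰 𝒱' 𝒱 h𝒰' h𝒰 h𝒱' h𝒱 φ⟩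

/-- In particular (the case used in Def 2.1 (ii): "when `𝒰`, `𝒱` are the sets of all connected open
subsets we omit the word (𝒰,𝒱)-local"): under `Rmk_2_3_2`, a (𝒰,𝒱)-local morphism for SOME pair of
local structures is a morphism of Aut-holomorphic spaces (`IsMorphism`), provided the connected open
subsets themselves form local structures (true on a Riemann surface, which is locally connected; taken
as hypotheses here). [cite: MochizukiAbsTopIII2015, Rmk 2.3.2 p.54] -/
theorem Rmk_2_3_2.isMorphism (h : Rmk_2_3_2) (X Y : Type) [TopologicalSpace X] [T2Space X]
    [ChartedSpace ℂ X] [IsManifold 𝓘(ℂ, ℂ) ω X] [TopologicalSpace Y] [T2Space Y] [ChartedSpace ℂ Y]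
    [IsManifold 𝓘(ℂ, ℂ) ω Y] {𝒰 : Set (Opens X)} {𝒱 : Set (Opens Y)} (h𝒰 : IsLocalStructure X 𝒰)
    (h𝒱 : IsLocalStructure Y 𝒱) (hX : IsLocalStructure X {U | IsConnected (U : Set X)})
    (hY : IsLocalStructure Y {V | IsConnected (V : Set Y)}) (φ : X → Y)
    (hφ : IsLocalMorphism (AutHolStructure.ofCharted X) (AutHolStructure.ofCharted Y) 𝒰 𝒱 φ) :
    IsMorphism (AutHolStructure.ofCharted X) (AutHolStructure.ofCharted Y) φ :=
  h X Y 𝒰 _ 𝒱 _ h𝒰 hX h𝒱 hY φ hφ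

end Literature.AnabelianGeometry.AbsoluteAnabelian.AbsTopIII
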